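import Mathlib
import Literature.Computability.Cryptography.QubitRegister
import Literature.Computability.QuantumComplexity.PauliExpansion
import HarnessLib

/-!
# Barrier catalogue `QuantumAdvantage` — the S-box dictionary: the Pauli spectrum of a data-loading state `Σₓ |x⟩|f(x)⟩` is the differential/linear profile of `f`

Topic `Literature/Barriers/QuantumAdvantage` (D-0021). Summit statement:
`QuantumAdvantage := ∃ L, L ∈ BQP ∧ L ∉ BPP`.

One of six entries that file the PROVED bounds of the retired route `SymplecticPurity`
(`Summits/QuantumAdvantage/QuantumAdvantage/Theses/SymplecticPurity.lean`, closed `retired` on the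
human ruling of 2026-08-16) as barrier items: `NoFreeFramePurityBound` (`symplecticPurityBound`),
`NoFreeFrameGaussianBound` (`gaussianDegreeBound`), `NoFreeFrameSBoxSpectrum` (this file, fact
`graphStateSpectrum`), `NoFreeFrameCubeAlmostBent` (`cubeAlmostBent`), `NoFreeFrameCubeGraphFlat`
(`cubeGraphFlat`), `NoFreeFrame` (`noFreeFrame`). The six files are independent (no mutual imports).

BARRIER: technique_class := classical simulators, compressions and resource monotones that need a
  PEAKED or SPARSE Pauli spectrum of the data-loading state `|x⟩|f(x)⟩` produced by a reversible
  classical subroutine `f : 𝔽₂ⁿ → 𝔽₂ⁿ` (S-box, modular arithmetic, …): Pauli-path / Pauli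
  back-propagation truncation, low stabilizer-Rényi-entropy or low-nullity assumptions, and — with the
  companion entries `symplecticPurityBound` / `gaussianDegreeBound` — free Clifford or matchgate
  frames, whose obstruction is exactly `ℓ∞`-flatness of that spectrum;
  blocks := for `f` with differential uniformity `≤ D` (`#{x : f(x ⊕ a) ⊕ f(x) = b} ≤ D` for all
  `a ≠ 0`, `b`) and linearity `≤ Λ` (`|Σ_x (−1)^{α·x ⊕ β·f(x)}| ≤ Λ` for all `β ≠ 0`, `α`), EVERY
  non-identity Pauli expectation of the unnormalised graph vector `g_f = Σ_x |x⟩|f(x)⟩` is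
  `≤ max(D, Λ)` in modulus (`graphStateSpectrum`), i.e. the normalised data-loading state is
  `max(D, Λ)/2ⁿ`-FLAT: resistance of `f` to differential AND linear cryptanalysis
  [cite: Nyberg1994] [cite: ChabaudVaudenay1995] is literally flatness of the quantum state that loads
  it; almost-perfect-nonlinear / almost-bent S-boxes (`x ↦ x³` on `𝔽_{2ⁿ}`: `D = 2`,
  `Λ ≤ 2^{⌊n/2⌋+1}` [cite: Carlet2020, §11.5.2 (PDF p. 497, Gold exponents) and PDF pp. 222–223 (Walsh transform of tr(wx³+ux))],
  companion entry `cubeAlmostBent`) give `2^{1−n/2}`-flat states on `2n` qubits (companion entry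
  `cubeGraphFlat`), within the factor `2` of the floor `Λ ≥ 2^{n/2}` forced by Parseval;
  because := a Pauli string with `X`-part `(a, a')` pairs the basis state `|x, f(x)⟩` with
  `|x ⊕ a, f(x) ⊕ a'⟩`, so `⟨g_f|σ_S|g_f⟩` is a sum of unit-modulus terms over the solutions of
  `f(x ⊕ a) = f(x) ⊕ a'` — at most `D` of them when `a ≠ 0`, none when `a = 0 ≠ a'` — while a
  `Z`-type string `(α, β)` gives the Walsh–Hadamard coefficient `Σ_x (−1)^{α·x ⊕ β·f(x)}` (`≤ Λ`
  when `β ≠ 0`, and `0` when `β = 0 ≠ α`): the quantum reading of the difference distribution table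
  and the linear approximation / Walsh table of S-box theory [folklore] — elementary, machine-checked
  in this tree (see `status`); for single-output Boolean functions (hypergraph / phase states) the
  analogous reduction of Pauli moments to Walsh sums of derivatives is [cite: ChenYanZhou2023, Thm. 1];
  evasions_known := functions with ONE large differential or Walsh coefficient are not flat —
  linear and affine maps (stabilizer states), maps with linear structures or near-linear components
  (e.g. the low output bits of modular addition), and structured arithmetic such as
  `x ↦ g^x mod p`, whose flatness is UNDECIDED (the retired route's open crux `DlogGraphFlat`,
  stmt-QuantumAdvantage-10732; refuter evidence on that item exhibits exact resonances
  `⟨X^a ⊗ X^{ā'}⟩ = 2^{n−1}` at Mersenne moduli); non-Pauli-basis monotones (stabilizer rank / extent,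
  Gaussian rank) are not bounded by flatness alone; states that are not graph vectors of functions;
  scope_caveats := (i) the graph vector is UNNORMALISED (`‖g_f‖² = 2ⁿ`); (ii) the registers are
  ordered input-first (`Fin.castAdd n` = input wires, `Fin.natAdd n` = output wires of
  `QReg (n + n)`); (iii) `D` and `Λ` are real parameters bounding the counts / the absolute Walsh
  sums as displayed (inner products over `𝔽₂ⁿ` are written as Boolean products `∏ (if αᵢ ∧ xᵢ then −1 else 1)`);
  (iv) the dictionary is an UPPER bound on the spectrum — it does not by itself assert that any `f`
  is good (that is `cubeAlmostBent`);
  status := theorem — MACHINE-CHECKED IN THIS TREE, Summits side: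
  `Summit.QuantumAdvantage.QuantumAdvantage.Theorems.SymplecticPurity.GraphStateSpectrum_proof`
  (file `Summits/QuantumAdvantage/QuantumAdvantage/Theorems/SymplecticPurityGraphStateSpectrum.lean`,
  293 lines, standard axioms) closed item stmt-QuantumAdvantage-9840 of route `SymplecticPurity`;
  typed below as a NAMED FACT only because `Literature` may not import `Summits` (CONVENTIONS §2):
  the body is token for token the route decl
  `Summit.QuantumAdvantage.QuantumAdvantage.Theses.SymplecticPurity.GraphStateSpectrum`
  (definitionally equal, `Iff.rfl`, and discharged by `exact GraphStateSpectrum_proof` in the filing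
  planner's scratch check, 2026-08-16), so the discharge of record is the ONE-LINE Summits-side
  `theorem graphStateSpectrum_holds : Literature.Barriers.QuantumAdvantage.graphStateSpectrum :=
  Summit.QuantumAdvantage.QuantumAdvantage.Theorems.SymplecticPurity.GraphStateSpectrum_proof` — do
  NOT re-prove it in `Literature`. Elementary; not located verbatim in print for vectorial `f`
  (nearest [cite: ChenYanZhou2023, Thm. 1], single-output `f`).

## Contents

* `graphStateSpectrum` — THE BARRIER FACT of this file (the only declaration).

## Design notes

* One named fact, no other declaration (D-0026 / `lint.fact-fanout`). `f` acts on the tree's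
  registers `QReg n = Fin n → Bool`; written inline over `QReg` (`QubitRegister.lean`) and `Pauli`,
  `pauliString` (`PauliExpansion.lean`) exactly as on the route, so that the tree theorem discharges
  it by `exact`; `open scoped Classical` matches the route file's elaboration context.

## References

* [Nyberg1994] K. Nyberg, *Differentially uniform mappings for cryptography*, EUROCRYPT '93, LNCS
  765 (1994) 55–64. [ChabaudVaudenay1995] F. Chabaud, S. Vaudenay, *Links between differential and
  linear cryptanalysis*, EUROCRYPT '94, LNCS 950 (1995) 356–365.
* [Carlet2020] C. Carlet, *Boolean Functions for Cryptography and Coding Theory*, CUP 2021: §11.5.2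
  (PDF p. 497), PDF pp. 222–223. Read via `lit read book:carlet2020-boolean-functions-cryptography-coding-theory`.
* [ChenYanZhou2023] J. Chen, Y. Yan, Y. Zhou, *Magic of quantum hypergraph states*, Quantum 8, 1351
  (arXiv:2308.01886): Thm. 1. Read.
-/

namespace Literature.Barriers.QuantumAdvantage

open scoped BigOperators Matrix ComplexConjugate Classical
open Literature.Computability.Cryptography Literature.Computability.QuantumComplexity

/-- **The S-box dictionary.** For `f : 𝔽₂ⁿ → 𝔽₂ⁿ` (on the registers `QReg n`) with differential
uniformity `≤ D` — `#{x : f(x ⊕ a) ⊕ f(x) = b} ≤ D` for all `a ≠ 0` and all `b` — and linearity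
`≤ Λ` — `|Σ_x (−1)^{α·x ⊕ β·f(x)}| ≤ Λ` for all `β ≠ 0` and all `α` — the unnormalised graph vector
`g_f = Σ_x |x⟩|f(x)⟩` on `n + n` qubits (input register first) satisfies `|⟨g_f|σ_S|g_f⟩| ≤ max(D, Λ)`
for every Pauli string `S ≠ I`; i.e. the normalised data-loading state of `f` is `max(D,Λ)/2ⁿ`-flat.
- technique_class: anything that needs a peaked / sparse Pauli spectrum of a data-loading state
  `|x⟩|f(x)⟩` (Pauli-path truncation, low stabilizer entropy / nullity, and via the companion
  entries free Clifford / matchgate frames)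
- blocks: such assumptions for S-boxes resistant to differential and linear cryptanalysis
  [cite: Nyberg1994] [cite: ChabaudVaudenay1995]; APN / almost-bent `x ↦ x³` gives `2^{1−n/2}`-flat
  states [cite: Carlet2020, §11.5.2 (PDF p. 497) and PDF pp. 222–223] (`cubeAlmostBent`, `cubeGraphFlat`)
- because: `X`-part `(a,a')` ↦ signed count of solutions of `f(x⊕a) = f(x)⊕a'` (`≤ D`; `0` if
  `a = 0 ≠ a'`); `Z`-type `(α,β)` ↦ Walsh coefficient (`≤ Λ`; `0` if `β = 0 ≠ α`) — DDT and LAT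
  read quantumly; single-output analogue [cite: ChenYanZhou2023, Thm. 1]
- evasions_known: `f` with a large differential or Walsh coefficient (affine maps, linear
  structures, modular-arithmetic resonances — flatness of `x ↦ g^x mod p` undecided, ex-crux
  `DlogGraphFlat` stmt-QuantumAdvantage-10732); non-Pauli monotones; non-graph states
- scope_caveats: unnormalised vector; input register = `Fin.castAdd`, output = `Fin.natAdd`; upper
  bound only
- status: theorem, machine-checked in this tree as
  `Summit.QuantumAdvantage.QuantumAdvantage.Theorems.SymplecticPurity.GraphStateSpectrum_proof`
  (item stmt-QuantumAdvantage-9840, route `SymplecticPurity`, retired 2026-08-16); named fact here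
  only because `Literature` does not import `Summits` — body definitionally equal to the route decl,
  discharge = the one-line Summits-side `graphStateSpectrum_holds := …GraphStateSpectrum_proof`
[folklore] -/
def graphStateSpectrum : Prop :=
  ∀ (n : ℕ) (f : QReg n → QReg n) (D Λ : ℝ),
    (∀ a : QReg n, a ≠ (fun _ => false) → ∀ b : QReg n,
      ((Finset.univ.filter fun x : QReg n =>
          (fun i => Bool.xor (f (fun j => Bool.xor (x j) (a j)) i) (f x i)) = b).card : ℝ) ≤ D) →
    (∀ β : QReg n, β ≠ (fun _ => false) → ∀ α : QReg n,
      |∑ x : QReg n, (∏ i, (if α i && x i then (-1 : ℝ) else 1)) *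
        (∏ i, (if β i && f x i then (-1 : ℝ) else 1))| ≤ Λ) →
    ∀ S : Fin (n + n) → Pauli, S ≠ (fun _ => Pauli.I) →
      ‖star (fun w : QReg (n + n) =>
            if (fun j : Fin n => w (Fin.natAdd n j)) = f (fun i : Fin n => w (Fin.castAdd n i))
            then (1 : ℂ) else 0) ⬝ᵥ
          (pauliString S).mulVec (fun w : QReg (n + n) =>
            if (fun j : Fin n => w (Fin.natAdd n j)) = f (fun i : Fin n => w (Fin.castAdd n i))
            then (1 : ℂ) else 0)‖ ≤ max D Λ

end Literature.Barriers.QuantumAdvantage
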